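import Literature.Topology.FourManifolds.FrameAlongMap
import Literature.Topology.FourManifolds.Spin
import HarnessLib

/-!
# Framings of an immersed manifold from ambient vector fields

Topic `Literature/Topology/FourManifolds`; infrastructure for the Pontryagin–Thom step of
Kervaire–Milnor, *Groups of homotopy spheres I*, Ann. of Math. 77 (1963), proof of Lemma 4.2
(p. 510: the bounding manifold `W = G⁻¹(y) ⊆ ℝᴺ` is framed by ambient vector fields tangent to
it) in the tree's language of framings along maps (`Spin.lean`:
`Literature.Topology.FourManifolds.HasTangentFramingAlong`,
`Literature.Topology.FourManifolds.HasStableTangentFramingAlong`).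

Let `e : Z → V` be a `C^∞` immersion of a manifold without boundary into a normed space, `φ : X → Z`
continuous, and `wᵢ : X → V` continuous ambient vector fields along `e ∘ φ` which are tangent to
the immersed manifold, `wᵢ(x) ∈ de(T_{φ x} Z)`.  Then the unique tangent vectors `sᵢ(x)` with
`de(sᵢ x) = wᵢ x` form a section of `φ*TZ` which is **continuous into the tangent bundle**
(`Literature.Topology.FourManifolds.continuous_totalSpaceMk_of_mfderiv_apply_eq`): near `φ x₀`
the immersion has a `C^∞` local left inverse `r` (the tree's
`Literature.Topology.FourManifolds.exists_local_leftInverse_of_isImmersionAt`,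
`FrameAlongMap.lean`),
so `sᵢ x = dr(wᵢ x)` is the image of the continuous section `x ↦ (e φ x, wᵢ x)` of the (trivial)
tangent bundle of `V` under the continuous tangent map of `r` (Mathlib's
`ContMDiffOn.continuousOn_tangentMapWithin`).  Hence pointwise linearly independent such families
of the right size are framings:

* `Literature.Topology.FourManifolds.hasTangentFramingAlong_of_ambient_frame` — `dim Z` fields
  give `HasTangentFramingAlong I Z φ`;
* `Literature.Topology.FourManifolds.hasStableTangentFramingAlong_of_ambient_frame` —
  `dim Z + 1` fields `(wᵢ, cᵢ) : X → V × ℝ` with `wᵢ` tangent give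
  `HasStableTangentFramingAlong I Z φ`.

(Hirsch, *Differential Topology* (1976), Ch. 4 §2: a frame of a sub-bundle of a trivial bundle,
read through a bundle monomorphism, is a trivialisation; Milnor–Stasheff, *Characteristic classes*
(1974), §2–§3.)  Everything here is proved; no definitions, no named facts.

## References

* M. W. Hirsch, *Differential Topology*, GTM 33 (1976), Ch. 4 §1 (p. 88), §2. [HirschDT1976]
* M. Kervaire, J. Milnor, *Groups of homotopy spheres I*, Ann. of Math. (2) 77 (1963), proof of
  Lemma 4.2 (p. 510). [KervaireMilnorAnnals1963]
-/

open scoped Manifold ContDiff Topology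
open Set Function Bundle Filter Module

noncomputable section

namespace Literature.Topology.FourManifolds

variable {EZ : Type*} [NormedAddCommGroup EZ] [NormedSpace ℝ EZ] {HZ : Type*} [TopologicalSpace HZ]
  {IZ : ModelWithCorners ℝ EZ HZ}
  {Z : Type*} [TopologicalSpace Z] [ChartedSpace HZ Z]
  {V : Type*} [NormedAddCommGroup V] [NormedSpace ℝ V]
  {X : Type*} [TopologicalSpace X]

/-- Transport of the base point of an element of the tangent bundle along an equality of points
(the fibres `TangentSpace I z = E` are definitionally constant). [folklore] -/
theorem totalSpaceMk_eq_of_eq {p q : Z} (h : p = q) (a : EZ) :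
    (TotalSpace.mk' EZ p a : TangentBundle IZ Z) = TotalSpace.mk' EZ q a := by
  subst h
  rfl

variable [IZ.Boundaryless] [IsManifold IZ ∞ Z]

/-- **Tangent vectors of an immersed manifold read from ambient vectors are continuous.**  Let
`e : Z → V` be a `C^∞` immersion of a manifold without boundary into a normed space,
`φ : X → Z` and `w : X → V` continuous, and `s x ∈ T_{φ x} Z` with `de_{φ x}(s x) = w x`.  Then
`x ↦ (φ x, s x)` is continuous into the tangent bundle `TZ`: near `φ x₀` a `C^∞` local left
inverse `r` of `e` gives `s x = dr_{e φ x}(w x)`, the continuous tangent map of `r` applied to the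
continuous section `x ↦ (e φ x, w x)` of `TV = V × V` (Hirsch, *Differential Topology* (1976),
Ch. 4 §1–§2: `Te` is a bundle monomorphism, and a left inverse splits it).
[cite: HirschDT1976, Ch. 4 §1 p. 88 and §2] -/
theorem continuous_totalSpaceMk_of_mfderiv_apply_eq {e : Z → V}
    (he : Manifold.IsImmersion IZ 𝓘(ℝ, V) ∞ e) {φ : X → Z} (hφ : Continuous φ)
    {w : X → V} (hw : Continuous w) {s : X → EZ}
    (hs : ∀ x, mfderiv IZ 𝓘(ℝ, V) e (φ x) (s x) = w x) :
    Continuous fun x ↦ (TotalSpace.mk' EZ (φ x) (s x) : TangentBundle IZ Z) := by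
  have h0 : (∞ : ℕ∞ω) ≠ 0 := by simp
  have h1 : (1 : ℕ∞ω) ≤ ∞ := by exact_mod_cast le_top
  have hesm : ContMDiff IZ 𝓘(ℝ, V) ∞ e := he.contMDiff
  rw [continuous_iff_continuousAt]
  intro x₀
  obtain ⟨O, hO, -, r, hr, U, hU, hxU, hUO, hre⟩ :=
    exists_local_leftInverse_of_isImmersionAt (he.isImmersionAt (φ x₀))
  -- on `φ⁻¹ U`, `s x = dr (w x)`
  have key : ∀ x, φ x ∈ U → s x = mfderivWithin 𝓘(ℝ, V) IZ r O (e (φ x)) (w x) := by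
    intro x hx
    have hreq : r ∘ e =ᶠ[𝓝 (φ x)] id := by
      filter_upwards [hU.mem_nhds hx] with y hy using hre y hy
    have hrd : MDifferentiableAt 𝓘(ℝ, V) IZ r (e (φ x)) :=
      (hr.contMDiffAt (hO.mem_nhds (hUO hx))).mdifferentiableAt h0
    have hed : MDifferentiableAt IZ 𝓘(ℝ, V) e (φ x) := hesm.mdifferentiableAt h0
    have hcomp := mfderiv_comp (φ x) hrd hed
    rw [hreq.mfderiv_eq, mfderiv_id] at hcomp
    have happ : s x = (mfderiv 𝓘(ℝ, V) IZ r (e (φ x))) (mfderiv IZ 𝓘(ℝ, V) e (φ x) (s x)) :=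
      DFunLike.congr_fun hcomp (s x)
    rw [hs x] at happ
    rw [mfderivWithin_of_isOpen hO (hUO hx)]
    exact happ
  -- the section `x ↦ (e φ x, w x)` of `TV` is continuous
  have hsec : Continuous fun x ↦ (TotalSpace.mk' V (e (φ x)) (w x) : TangentBundle 𝓘(ℝ, V) V) := by
    have heq : (fun x ↦ (TotalSpace.mk' V (e (φ x)) (w x) : TangentBundle 𝓘(ℝ, V) V)) =
        (tangentBundleModelSpaceHomeomorph (H := V) 𝓘(ℝ, V)).symm ∘ fun x ↦ (e (φ x), w x) := by
      funext x
      rw [comp_apply, tangentBundleModelSpaceHomeomorph_coe_symm]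
      rfl
    rw [heq]
    exact (tangentBundleModelSpaceHomeomorph (H := V) 𝓘(ℝ, V)).symm.continuous.comp
      ((hesm.continuous.comp hφ).prodMk hw)
  -- the tangent map of `r` is continuous on `TV|O`
  have htm : ContinuousOn (tangentMapWithin 𝓘(ℝ, V) IZ r O)
      (π V (TangentSpace 𝓘(ℝ, V)) ⁻¹' O) :=
    hr.continuousOn_tangentMapWithin h1 hO.uniqueMDiffOn
  have hcomp : ContinuousAt (fun x ↦ tangentMapWithin 𝓘(ℝ, V) IZ r O
      (TotalSpace.mk' V (e (φ x)) (w x) : TangentBundle 𝓘(ℝ, V) V)) x₀ := by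
    refine ContinuousAt.comp (htm.continuousAt ?_) hsec.continuousAt
    exact (hO.preimage (FiberBundle.continuous_proj V (TangentSpace 𝓘(ℝ, V)))).mem_nhds
      (hUO hxU)
  refine hcomp.congr ?_
  filter_upwards [hφ.continuousAt.eventually_mem (hU.mem_nhds hxU)] with x hx
  show TotalSpace.mk' EZ (r (e (φ x))) (mfderivWithin 𝓘(ℝ, V) IZ r O (e (φ x)) (w x)) =
    TotalSpace.mk' EZ (φ x) (s x)
  rw [← key x hx]
  exact totalSpaceMk_eq_of_eq (hre _ hx) (s x)

/-- **A frame of the immersed tangent planes along a map is a framing along the map.**  With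
`e : Z → V` a `C^∞` immersion of a manifold without boundary into a normed space and `φ : X → Z`
continuous, `dim Z` continuous ambient fields `wᵢ : X → V` tangent to the immersed manifold
(`wᵢ x ∈ range de_{φ x}`) and linearly independent at each point give a framing of `TZ` along `φ`
(`HasTangentFramingAlong`): the fields `sᵢ` with `de(sᵢ) = wᵢ` (Hirsch 1976, Ch. 4 §2; the frame
fields over `W ⊆ ℝᴺ` in Kervaire–Milnor's proof of Lemma 4.2). [cite: HirschDT1976, Ch. 4 §2] -/
theorem hasTangentFramingAlong_of_ambient_frame {e : Z → V}
    (he : Manifold.IsImmersion IZ 𝓘(ℝ, V) ∞ e) {φ : X → Z} (hφ : Continuous φ)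
    {w : Fin (finrank ℝ EZ) → X → V} (hw : ∀ i, Continuous (w i))
    (hwr : ∀ i x, ∃ u : EZ, mfderiv IZ 𝓘(ℝ, V) e (φ x) u = w i x)
    (hli : ∀ x, LinearIndependent ℝ fun i ↦ w i x) : HasTangentFramingAlong IZ Z φ := by
  choose s hs using hwr
  refine ⟨s, fun i ↦ continuous_totalSpaceMk_of_mfderiv_apply_eq he hφ (hw i) (hs i),
    fun x ↦ ?_⟩
  set A : EZ →L[ℝ] V := mfderiv IZ 𝓘(ℝ, V) e (φ x) with hA
  have heq : (fun i ↦ w i x) = (A : EZ →ₗ[ℝ] V) ∘ fun i ↦ s i x :=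
    funext fun i ↦ (hs i x).symm
  have h := hli x
  rw [heq] at h
  exact LinearIndependent.of_comp _ h

/-- **A stable frame of the immersed tangent planes along a map is a stable framing along the
map.**  As `hasTangentFramingAlong_of_ambient_frame`, for `dim Z + 1` continuous fields
`(wᵢ, cᵢ) : X → V × ℝ` with `wᵢ` tangent to the immersed manifold and `(wᵢ, cᵢ)` linearly
independent at each point: the pairs `(sᵢ, cᵢ)`, `de(sᵢ) = wᵢ`, frame `φ*TZ ⊕ ℝ`
(`HasStableTangentFramingAlong`; Kervaire–Milnor 1963, §3: s-parallelisable = `TW ⊕ ε¹` trivial).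
[cite: KervaireMilnorAnnals1963, §3 (p. 508) and proof of Lemma 4.2 (p. 510)] -/
theorem hasStableTangentFramingAlong_of_ambient_frame {e : Z → V}
    (he : Manifold.IsImmersion IZ 𝓘(ℝ, V) ∞ e) {φ : X → Z} (hφ : Continuous φ)
    {w : Fin (finrank ℝ EZ + 1) → X → V × ℝ} (hw : ∀ i, Continuous (w i))
    (hwr : ∀ i x, ∃ u : EZ, mfderiv IZ 𝓘(ℝ, V) e (φ x) u = (w i x).1)
    (hli : ∀ x, LinearIndependent ℝ fun i ↦ w i x) : HasStableTangentFramingAlong IZ Z φ := by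
  choose s hs using hwr
  refine ⟨fun i x ↦ (s i x, (w i x).2),
    fun i ↦ continuous_totalSpaceMk_of_mfderiv_apply_eq he hφ (hw i).fst (hs i),
    fun i ↦ (hw i).snd, fun x ↦ ?_⟩
  set A₁ : EZ →L[ℝ] V := mfderiv IZ 𝓘(ℝ, V) e (φ x) with hA₁
  set A : (EZ × ℝ) →ₗ[ℝ] (V × ℝ) := (A₁ : EZ →ₗ[ℝ] V).prodMap LinearMap.id with hA
  have heq : (fun i ↦ w i x) = A ∘ fun i ↦ (s i x, (w i x).2) := by
    funext i
    show w i x = A (s i x, (w i x).2)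
    rw [hA, LinearMap.prodMap_apply, LinearMap.id_apply]
    exact Prod.ext (hs i x).symm rfl
  have h := hli x
  rw [heq] at h
  exact LinearIndependent.of_comp _ h

end Literature.Topology.FourManifolds

end
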